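import Summits.ValiantsHypothesis.ValiantsHypothesis.Theorems.LacunarySymmetroidMatrixDescartesCensusCertificates

/-!
# `MatrixDescartes` census — the `m = 2` pair-sum expansion and the Gram-rank identity (algebraic half of P5)

HONEST FRAMING.  Object-search cell `pub-symmetroid`, crux `Theses.LacunarySymmetroid.MatrixDescartes`
(stmt-ValiantsHypothesis-18050).  Two folklore identities used throughout the cell's `m = 2` analysis (theory's
CONJECTURE.md §5 P5 «Schur certificates», §15 dictionary; engine-6's Gram scan), typed so that the support-level
upper-bound discussion has a kernel anchor for its ALGEBRAIC step:

* `det_pencil_two_eq_pairSum` — for `2 × 2` coefficient matrices, `det (∑ l, t^(d l) • S l) = ∑ l l', t^(d l + d l') ·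
  (S l ₀₀ S l' ₁₁ − S l ₀₁ S l' ₁₀)`: the determinant of the pencil is the pair sum of the polarised determinant form
  (for symmetric `S l` the summand is `B(S l, S l')`, `B(S,T) = S₀₀T₁₁ + S₁₁T₀₀ − 2 S₀₁T₀₁` halved and symmetrised);
* `gram_det_four_eq_zero` — for ANY four symmetric `2 × 2` matrices the `4 × 4` matrix `(B(S i, S j))` is singular:
  `Sym₂(ℝ)` is `3`-dimensional, so a Gram matrix of four of its elements (for any bilinear form) has rank `≤ 3`.
  This is the step «`det M(c) = 0`» of P5; the ANALYTIC half of P5 (generalised-Vandermonde kernel = bialternant /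
  Schur vector, Schur-positivity ⇒ no positive zero) is NOT formalised here and is not claimed.

Nothing here bears on the asymptotic crux nor on `VP ≠ VNP`. [folklore] Elementary algebra (`ring`).
-/

-- `Summit.ValiantsHypothesis.ValiantsHypothesis.…` repeats a component by the D-0017 layout
-- (single-conjunct summit), which the `dupNamespace` linter flags; the name is mandated.
set_option linter.dupNamespace false

namespace Summit.ValiantsHypothesis.ValiantsHypothesis.Theorems.LacunarySymmetroidMatrixDescartes.Census

open scoped BigOperators Matrix

/-- Entries of a pencil evaluated at a real point: `(∑ l, t^(d l) • S l) i j = ∑ l, t^(d l) * S l i j`. [folklore] -/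
theorem pencil_apply {m K : ℕ} (d : Fin K → ℕ) (S : Fin K → Matrix (Fin m) (Fin m) ℝ) (t : ℝ) (i j : Fin m) :
    (∑ l, t ^ d l • S l) i j = ∑ l, t ^ d l * S l i j := by
  simp [Matrix.sum_apply, Matrix.smul_apply]

/-- **Pair-sum expansion at `m = 2`.**  For `2 × 2` coefficient matrices (symmetric or not),
`det (∑ l, t^(d l) • S l) = ∑ l, ∑ l', t^(d l + d l') · (S l 0 0 · S l' 1 1 − S l 0 1 · S l' 1 0)`; for symmetric
`S l` the symmetrised summand is the polarised determinant form `B(S l, S l')`, so the coefficient of `x^e` in `det F`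
is `∑_{d l + d l' = e} B(S l, S l')` — the «letters / Gram» dictionary of the cell's `m = 2` theory. [folklore] -/
theorem det_pencil_two_eq_pairSum {K : ℕ} (d : Fin K → ℕ) (S : Fin K → Matrix (Fin 2) (Fin 2) ℝ) (t : ℝ) :
    (∑ l, t ^ d l • S l).det =
      ∑ l, ∑ l', t ^ (d l + d l') * (S l 0 0 * S l' 1 1 - S l 0 1 * S l' 1 0) := by
  rw [Matrix.det_fin_two, pencil_apply, pencil_apply, pencil_apply, pencil_apply, Finset.sum_mul_sum,
    Finset.sum_mul_sum, ← Finset.sum_sub_distrib]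
  refine Finset.sum_congr rfl fun l _ => ?_
  rw [← Finset.sum_sub_distrib]
  refine Finset.sum_congr rfl fun l' _ => ?_
  rw [pow_add]
  ring

/-- **Gram-rank identity (P5, algebraic half).**  For any four symmetric `2 × 2` real matrices `S 0, …, S 3`, the
`4 × 4` matrix of polarised determinant forms `B(S i, S j) = S i 0 0 · S j 1 1 + S i 1 1 · S j 0 0 − 2 · S i 0 1 · S j 0 1`
has determinant `0` — four vectors in the `3`-space `Sym₂(ℝ)` have a singular Gram matrix for every bilinear form.
(Stated with the off-diagonal entry `S · 0 1` on both sides, so no symmetry hypothesis is needed: it is a polynomial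
identity in the twelve entries `S i 0 0, S i 0 1, S i 1 1`.) [folklore] -/
theorem gram_det_four_eq_zero (S : Fin 4 → Matrix (Fin 2) (Fin 2) ℝ) :
    (Matrix.of fun i j : Fin 4 =>
        S i 0 0 * S j 1 1 + S i 1 1 * S j 0 0 - 2 * (S i 0 1 * S j 0 1)).det = 0 := by
  rw [det_fin_four]
  simp only [Matrix.of_apply]
  ring

/-! ## Appended 2026-08-23 (typer gen 3): the two sign facts F2, F3 behind the (2,6) sign-class certificate C22

The cell's layer-1 support certificate at `(2,K)` (STRUCTURE.md C22, «PROVED per support, elementary», two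
implementations) rests on four facts F0–F3: F0 = `det_pencil_two_eq_pairSum` above, F1 = Descartes' rule with full
alternation, F2 = «`det S > 0` iff `S` is definite» for symmetric `2 × 2` matrices, F3 = «`B(S,T) > 0` for two positive
definite `S, T`» (AM–GM).  F2 and F3 are typed here in entry coordinates (`S = [[a, b], [b, c]]`); the per-support
2-colourability argument itself is NOT formalised. -/

/-- **F2.**  For a real symmetric `2 × 2` matrix `[[a,b],[b,c]]`: `det > 0`, i.e. `a·c − b² > 0`, forces `a` and `c` to
have the same strict sign — the matrix is positive or negative definite. [folklore] -/
theorem two_by_two_det_pos_iff_definite (a b c : ℝ) :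
    0 < a * c - b ^ 2 ↔ (0 < a ∧ 0 < c ∧ b ^ 2 < a * c) ∨ (a < 0 ∧ c < 0 ∧ b ^ 2 < a * c) := by
  constructor
  · intro h
    have hb : 0 ≤ b ^ 2 := sq_nonneg b
    have hac : 0 < a * c := by linarith
    rcases lt_trichotomy a 0 with ha | ha | ha
    · right
      exact ⟨ha, by nlinarith, by linarith⟩
    · exfalso; subst ha; simp at hac
    · left
      exact ⟨ha, by nlinarith, by linarith⟩
  · rintro (⟨-, -, h⟩ | ⟨-, -, h⟩) <;> linarith

/-- **F3 (AM–GM).**  For two positive definite real symmetric `2 × 2` matrices `[[a,b],[b,c]]` and `[[a',b'],[b',c']]`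
the polarised determinant form is positive: `a·c' + c·a' − 2·b·b' > 0`.  (Hence two positive definite letters never
cancel in a pair coefficient of `det F` — the typing rule of the C22 certificate.) [folklore] -/
theorem polarDet_pos_of_posDef (a b c a' b' c' : ℝ) (ha : 0 < a) (hc : 0 < c) (hS : b ^ 2 < a * c)
    (ha' : 0 < a') (hc' : 0 < c') (hT : b' ^ 2 < a' * c') :
    0 < a * c' + c * a' - 2 * (b * b') := by
  nlinarith [sq_nonneg (a * c' - c * a'), sq_nonneg (b * c' - b' * c), sq_nonneg (b * a' - b' * a),
    mul_pos ha hc', mul_pos hc ha', mul_pos ha ha', mul_pos hc hc', sq_nonneg (b - b'), sq_nonneg (b + b')]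

end Summit.ValiantsHypothesis.ValiantsHypothesis.Theorems.LacunarySymmetroidMatrixDescartes.Census
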